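import Summits.BirchSwinnertonDyer.BirchSwinnertonDyer.Theorems.ErratumRoadFiveRegCertKernelFiveSeries
import Summits.BirchSwinnertonDyer.BirchSwinnertonDyer.Theorems.ClassRecordThreeRung62310y1HeightEvalFormalLog
import HarnessLib
/-!
# Route `ErratumRoadFive` (rung K2, `p ≥ 5`): the REG5CERT KERNEL EVALUATOR, part 2 — the formal logarithm to second
# order over `ℚ₅` and the two Iwasawa logarithms UNEXPANDED
# (cell `bsd-stepL`, seat `bsd-stepL-reg3-eng` g5; `--supports stmt-BirchSwinnertonDyer-19703`)

HONEST FRAMING: BSD is not proved by any of this; nothing here closes a crux; Schneider's non-degeneracy conjecture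
(barrier `Literature.Barriers.BirchSwinnertonDyer.PAdicHeightNondegeneracy`) is asserted NOWHERE. `p = 5` twins of the
seat's `p = 3` lemmas (`…Rung62310y1HeightEvalFormalLog` §C3, `…RegCertKernelUniformLog` §4); theorems only (0 defs, 0 facts):

* §3 `norm_padicFormalLog_sub_quadratic_le` — `‖log_Ŵ(z) − (z + a₁z²/2)‖₅ ≤ 5⁻⁶` for `‖z‖₅ ≤ 5⁻²`, `Ŵ` `5`-integral
  (coefficients `coeff_two_formalLog` of part C of the `p = 3` evaluator, generic over `ℚ`-algebras; tail by
  `‖coeff n‖ ≤ ‖1/n‖₅`);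
* §4 `padicLog_ne_padicLog_of_unitResidue` — `log₅ A = log₅ B` with `A ≡ Pα`, `B ≡ Pβ` to relative precision `5⁻ᴺ`
  (`α, β` units) forces `A⁴ = B⁴` (multiplicativity `padicLog_mul_holds`, `log₅ x = 4⁻¹L((x5^{−v})⁴)`, and
  `‖L(y) + (1 − y)‖ ≤ ‖1 − y‖²` on principal units), hence `5^N ∣ β⁴ − α⁴`: a height certificate becomes ONE integer
  fact `5^N ∤ β⁴ − α⁴` — no logarithmic series is evaluated.

References: [SilvermanAEC2009] IV.5.5, IV.6.3–6.4; [Iwasawa1972PadicL] §4.4.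
-/

open scoped Classical

open Filter Topology PowerSeries IsUltrametricDist WeierstrassCurve Literature.NumberTheory.EllipticCurves
  Literature.NumberTheory.EllipticCurves.SteinWuthrich2013
  Summit.BirchSwinnertonDyer.Rank1Residual.X11b.RegMult.Rung62310y1

namespace Summit.BirchSwinnertonDyer.Rank1Residual.X11b.RegMult.KernelCertFive

variable [Fact (Nat.Prime 5)]

/-! ### §3 Over `ℚ₅`: `log_Ŵ(z) = z + (a₁/2)z² + O(5⁻⁶)` for `‖z‖₅ ≤ 5⁻²` -/

section Padic

variable (V : WeierstrassCurve ℚ_[5]) [V.IsIntegral ℤ_[5]]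

/-- Sharp form of the tree's `norm_coeff_formalLog_le` at `p = 5`: `‖coeff (n+2) log_Ŵ‖₅ ≤ ‖1/(n+2)‖₅` (`ω ∈ ℤ₅⟦z⟧`).
[Silverman AEC IV.5.5, IV.6.3] [cite: SilvermanAEC2009, IV.6.3] -/
theorem norm_coeff_formalLog_le_norm_inv (n : ℕ) :
    ‖coeff (n + 2) V.formalLog‖ ≤ ‖(((n + 2 : ℕ) : ℚ_[5]))⁻¹‖ := by
  rw [WeierstrassCurve.formalLog, coeff_mk]
  dsimp only
  rw [norm_mul, map_div₀, map_one, one_div]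
  have h1 : (algebraMap ℚ ℚ_[5] (n + 2 : ℚ)) = ((n + 2 : ℕ) : ℚ_[5]) := by
    rw [map_add, map_natCast, map_ofNat]; push_cast; ring
  rw [h1]
  have h2 : ‖coeff (n + 1) V.formalOmega‖ ≤ 1 := isPadicInt_iff_coeff.mp V.isPadicInt_formalOmega _
  calc ‖(((n + 2 : ℕ) : ℚ_[5]))⁻¹‖ * ‖coeff (n + 1) V.formalOmega‖ ≤ ‖(((n + 2 : ℕ) : ℚ_[5]))⁻¹‖ * 1 := by gcongr
    _ = _ := mul_one _

omit [Fact (Nat.Prime 5)] in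
/-- `5⁶·m ≤ 25ᵐ` for `m ≥ 5`. [folklore] -/
private theorem pow_six_mul_le_pow {m : ℕ} (hm : 5 ≤ m) : 5 ^ 6 * m ≤ 25 ^ m := by
  induction m with
  | zero => omega
  | succ k ih =>
    rcases Nat.lt_or_ge k 5 with hk | hk
    · obtain rfl : k = 4 := by omega
      norm_num
    · have h6 : 5 ^ 6 ≤ 25 ^ k := le_trans (by norm_num : 5 ^ 6 ≤ 25 ^ 5) (Nat.pow_le_pow_right (by norm_num) hk)
      calc 5 ^ 6 * (k + 1) = 5 ^ 6 * k + 5 ^ 6 := by ring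
        _ ≤ 25 ^ k + 25 ^ k := Nat.add_le_add (ih hk) h6
        _ ≤ 25 ^ (k + 1) := by rw [pow_succ]; omega

/-- The terms of degree `≥ 3` of `log_Ŵ(z)` have norm `≤ 5⁻⁶` for `‖z‖₅ ≤ 5⁻²` (`n = 3, 4` are `5`-adic units, and
`‖1/n‖₅ ≤ n ≤ 25ⁿ/5⁶` for `n ≥ 5`). [Silverman AEC IV.6.3] [cite: SilvermanAEC2009, IV.6.3] -/
private theorem norm_formalLog_term_le {z : ℚ_[5]} (hz : ‖z‖ ≤ 1 / 25) (n : ℕ) :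
    ‖coeff (n + 3) V.formalLog * z ^ (n + 3)‖ ≤ 1 / 5 ^ 6 := by
  rw [norm_mul, norm_pow]
  have hc := (norm_coeff_formalLog_le_norm_inv V) (n + 1)
  rw [show n + 1 + 2 = n + 3 by ring] at hc
  have hzn : ‖z‖ ^ (n + 3) ≤ (1 / 25 : ℝ) ^ (n + 3) := by gcongr
  rcases Nat.lt_or_ge n 2 with hn | hn
  · -- `n + 3 ∈ {3, 4}`: `5 ∤ n + 3`
    have hunit : ‖(((n + 3 : ℕ) : ℚ_[5]))⁻¹‖ = 1 := by
      rw [norm_inv, Padic.norm_eq_zpow_neg_valuation (by exact_mod_cast (show (n + 3 : ℕ) ≠ 0 by omega)),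
        Padic.valuation_natCast,
        padicValNat.eq_zero_of_not_dvd (by interval_cases n <;> norm_num)]
      simp
    calc ‖coeff (n + 3) V.formalLog‖ * ‖z‖ ^ (n + 3) ≤ 1 * (1 / 25 : ℝ) ^ (n + 3) := by
          gcongr; exact hc.trans hunit.le
      _ ≤ 1 * (1 / 25 : ℝ) ^ 3 :=
          mul_le_mul_of_nonneg_left (pow_le_pow_of_le_one (by norm_num) (by norm_num) (by omega)) (by norm_num)
      _ = 1 / 5 ^ 6 := by norm_num
  · have hm : ‖(((n + 3 : ℕ) : ℚ_[5]))⁻¹‖ ≤ ((n + 3 : ℕ) : ℝ) := padic_norm_inv_natCast_le (n + 3)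
    have hpow := pow_six_mul_le_pow (show 5 ≤ n + 3 by omega)
    have hpow' : ((5 : ℝ) ^ 6) * ((n + 3 : ℕ) : ℝ) ≤ (25 : ℝ) ^ (n + 3) := by exact_mod_cast hpow
    calc ‖coeff (n + 3) V.formalLog‖ * ‖z‖ ^ (n + 3) ≤ ((n + 3 : ℕ) : ℝ) * (1 / 25 : ℝ) ^ (n + 3) := by
          gcongr; exact hc.trans hm
      _ = ((n + 3 : ℕ) : ℝ) / (25 : ℝ) ^ (n + 3) := by rw [one_div, inv_pow]; ring
      _ ≤ 1 / 5 ^ 6 := by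
          rw [div_le_div_iff₀ (by positivity) (by norm_num)]
          linarith

/-- **`log_Ŵ(z) = z + (a₁/2)z² + O(5⁻⁶)` on `‖z‖₅ ≤ 5⁻²`** for a `5`-integral equation over `ℚ₅`:
`‖padicFormalLog Ŵ z − (z + 2⁻¹a₁z²)‖₅ ≤ 5⁻⁶` (two terms explicit — `coeff_one_formalLog`, `coeff_two_formalLog` —, tail
by the ultrametric `tsum` bound). [Silverman AEC IV.5.5, IV.6.4] [cite: SilvermanAEC2009, IV.6.4] -/
theorem norm_padicFormalLog_sub_quadratic_le {z : ℚ_[5]} (hz : ‖z‖ ≤ 1 / 25) :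
    ‖V.padicFormalLog z - (z + (2 : ℚ_[5])⁻¹ * V.a₁ * z ^ 2)‖ ≤ 1 / 5 ^ 6 := by
  have hs := V.summable_formalLog_of_isIntegral z (hz.trans_lt (by norm_num))
  have hsplit := hs.sum_add_tsum_nat_add 3
  have h0 : coeff 0 V.formalLog = 0 := by rw [coeff_zero_eq_constantCoeff]; exact V.constantCoeff_formalLog
  have h2 : coeff 2 V.formalLog = (2 : ℚ_[5])⁻¹ * V.a₁ := by
    rw [(coeff_two_formalLog V), eq_ratCast]; push_cast; ring
  have hthree : ∑ i ∈ Finset.range 3, coeff i V.formalLog * z ^ i = z + (2 : ℚ_[5])⁻¹ * V.a₁ * z ^ 2 := by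
    simp only [Finset.sum_range_succ, Finset.sum_range_zero, h0, V.coeff_one_formalLog, h2]
    ring
  rw [WeierstrassCurve.padicFormalLog, ← hsplit, hthree, add_sub_cancel_left]
  exact IsUltrametricDist.norm_tsum_le_of_forall_le_of_nonneg (by norm_num) fun n ↦ (norm_formalLog_term_le V) hz n

end Padic

/-! ### §4 The two Iwasawa logarithms, unexpanded: equal logs at equal valuation force equal fourth powers -/

/-- **Equal Iwasawa logarithms with certified unit parts are impossible (`p = 5`).** Let `P ≠ 0` in `ℚ₅`, `α, β`
integers prime to `5`, `‖A − Pα‖ ≤ ‖P‖·5⁻ᴺ`, `‖B − Pβ‖ ≤ ‖P‖·5⁻ᴺ` (`N ≥ 1`). If `log₅ A = log₅ B` then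
(multiplicativity, `padicLog_mul_holds`) `log₅ (A/B) = 0` with `A/B` a unit, so `L((A/B)⁴) = 0` for the principal-unit
series `L` (`log₅ x = 4⁻¹L((x5^{−v})⁴)`), whose first-order estimate `‖L(y) + (1 − y)‖ ≤ ‖1 − y‖²`
(`norm_padicLogSeries_add_le`) forces `(A/B)⁴ = 1`, i.e. `A⁴ = B⁴`, whence `5^N ∣ β⁴ − α⁴`. So
**`5^N ∤ β⁴ − α⁴ ⇒ log₅ A ≠ log₅ B`** — no logarithmic series is evaluated. [cite: Iwasawa1972PadicL, §4.4] -/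
theorem padicLog_ne_padicLog_of_unitResidue {A B P : ℚ_[5]} {α β : ℤ} {N : ℕ} (hP : P ≠ 0)
    (h5α : ¬ (5 : ℤ) ∣ α) (h5β : ¬ (5 : ℤ) ∣ β) (hN : 1 ≤ N)
    (hA : ‖A - P * α‖ ≤ ‖P‖ / (5 : ℝ) ^ N) (hB : ‖B - P * β‖ ≤ ‖P‖ / (5 : ℝ) ^ N)
    (hcert : ¬ (5 : ℤ) ^ N ∣ β ^ 4 - α ^ 4) : padicLog 5 A ≠ padicLog 5 B := by
  have hαn : ‖(α : ℚ_[5])‖ = 1 := norm_intCast_eq_one_of_not_dvd h5α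
  have hβn : ‖(β : ℚ_[5])‖ = 1 := norm_intCast_eq_one_of_not_dvd h5β
  have hPpos : 0 < ‖P‖ := norm_pos_iff.mpr hP
  have hN5 : ‖P‖ / (5 : ℝ) ^ N < ‖P‖ := by
    rw [div_lt_iff₀ (by positivity)]
    have : (1 : ℝ) < (5 : ℝ) ^ N := one_lt_pow₀ (by norm_num) (by omega)
    nlinarith
  -- `‖A‖ = ‖B‖ = ‖P‖`
  have hAn : ‖A‖ = ‖P‖ := by
    have h : ‖A - P * α‖ < ‖P * (α : ℚ_[5])‖ := by rw [norm_mul, hαn, mul_one]; exact hA.trans_lt hN5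
    rw [Padic.norm_eq_of_norm_sub_lt_right h, norm_mul, hαn, mul_one]
  have hBn : ‖B‖ = ‖P‖ := by
    have h : ‖B - P * β‖ < ‖P * (β : ℚ_[5])‖ := by rw [norm_mul, hβn, mul_one]; exact hB.trans_lt hN5
    rw [Padic.norm_eq_of_norm_sub_lt_right h, norm_mul, hβn, mul_one]
  have hA0 : A ≠ 0 := by intro h; rw [h, norm_zero] at hAn; exact hPpos.ne hAn
  have hB0 : B ≠ 0 := by intro h; rw [h, norm_zero] at hBn; exact hPpos.ne hBn
  -- the unit parts `A/P`, `B/P` are within `5⁻ᴺ` of `α`, `β`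
  have hA' : ‖A * P⁻¹ - α‖ ≤ 1 / (5 : ℝ) ^ N := by
    have : A * P⁻¹ - α = (A - P * α) * P⁻¹ := by field_simp
    rw [this, norm_mul, norm_inv]
    calc ‖A - P * α‖ * ‖P‖⁻¹ ≤ ‖P‖ / (5 : ℝ) ^ N * ‖P‖⁻¹ := by gcongr
      _ = 1 / (5 : ℝ) ^ N := by field_simp
  have hB' : ‖B * P⁻¹ - β‖ ≤ 1 / (5 : ℝ) ^ N := by
    have : B * P⁻¹ - β = (B - P * β) * P⁻¹ := by field_simp
    rw [this, norm_mul, norm_inv]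
    calc ‖B - P * β‖ * ‖P‖⁻¹ ≤ ‖P‖ / (5 : ℝ) ^ N * ‖P‖⁻¹ := by gcongr
      _ = 1 / (5 : ℝ) ^ N := by field_simp
  intro hlog
  -- `ξ = A/B` is a unit with `log₅ ξ = 0`
  set ξ : ℚ_[5] := A * B⁻¹ with hξ
  have hξn : ‖ξ‖ = 1 := by rw [hξ, norm_mul, norm_inv, hAn, hBn]; field_simp
  have hξ0 : ξ ≠ 0 := by intro h; rw [h, norm_zero] at hξn; exact zero_ne_one hξn
  have hlog1 : padicLog 5 (1 : ℚ_[5]) = 0 :=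
    (padicLog_eq_zero_iff_holds 5 one_ne_zero).mpr ⟨0, 1, one_pos, by simp⟩
  have hlogBinv : padicLog 5 B⁻¹ = -padicLog 5 B := by
    have h := padicLog_mul_holds 5 hB0 (inv_ne_zero hB0)
    rw [mul_inv_cancel₀ hB0, hlog1] at h
    linear_combination -h
  have hlogξ : padicLog 5 ξ = 0 := by
    rw [hξ, padicLog_mul_holds 5 hA0 (inv_ne_zero hB0), hlogBinv, hlog, add_neg_cancel]
  -- `log₅ ξ = 4⁻¹ L(ξ⁴)` at valuation `0`
  have hval : ξ.valuation = 0 := by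
    refine valuation_eq_of_norm_eq hξ0 ?_
    rw [hξn]; simp
  have hL : padicLogSeries 5 (ξ ^ 4) = 0 := by
    have h := padicLog_of_ne_zero hξ0
    rw [hval, neg_zero, zpow_zero, mul_one, show (5 : ℕ) - 1 = 4 from rfl, hlogξ] at h
    have h4 : ((5 : ℕ) : ℚ_[5]) - 1 = 4 := by norm_num
    rw [h4] at h
    have h40 : (4 : ℚ_[5])⁻¹ ≠ 0 := inv_ne_zero (by norm_num)
    rcases mul_eq_zero.mp h.symm with h' | h'
    · exact absurd h' h40
    · exact h'
  -- `‖1 − ξ⁴‖ < 1`, and `L(ξ⁴) = 0` forces `ξ⁴ = 1`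
  have h1ξ : ‖1 - ξ ^ 4‖ < 1 := by
    have := norm_one_sub_pow_sub_one_lt (p := 5) hξn
    rwa [show (5 : ℕ) - 1 = 4 from rfl] at this
  have hξ4 : ξ ^ 4 = 1 := by
    by_contra hne
    have ht0 : 1 - ξ ^ 4 ≠ 0 := sub_ne_zero.mpr (Ne.symm hne)
    have htpos : 0 < ‖1 - ξ ^ 4‖ := norm_pos_iff.mpr ht0
    have hest := norm_padicLogSeries_add_le (p := 5) h1ξ
    rw [hL, zero_add, norm_inv_two₅, mul_one] at hest
    have : ‖1 - ξ ^ 4‖ < ‖1 - ξ ^ 4‖ := by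
      calc ‖1 - ξ ^ 4‖ ≤ ‖1 - ξ ^ 4‖ ^ 2 := hest
        _ = ‖1 - ξ ^ 4‖ * ‖1 - ξ ^ 4‖ := sq _
        _ < ‖1 - ξ ^ 4‖ * 1 := by gcongr
        _ = ‖1 - ξ ^ 4‖ := mul_one _
    exact lt_irrefl _ this
  -- hence `(A/P)⁴ = (B/P)⁴` and `5^N ∣ α⁴ − β⁴`
  have hsq : (A * P⁻¹) ^ 4 = (B * P⁻¹) ^ 4 := by
    have hAB : A ^ 4 = B ^ 4 := by
      have h1 : A = ξ * B := by rw [hξ]; field_simp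
      rw [h1, mul_pow, hξ4, one_mul]
    rw [mul_pow, mul_pow, hAB]
  have hle1A : ‖A * P⁻¹‖ ≤ 1 := by rw [norm_mul, norm_inv, hAn]; field_simp; rfl
  have hle1B : ‖B * P⁻¹‖ ≤ 1 := by rw [norm_mul, norm_inv, hBn]; field_simp; rfl
  have hdiff : ‖(((α ^ 4 - β ^ 4 : ℤ)) : ℚ_[5])‖ ≤ 1 / (5 : ℝ) ^ N := by
    have hid : (((α ^ 4 - β ^ 4 : ℤ)) : ℚ_[5]) =
        ((α : ℚ_[5]) - A * P⁻¹) * (((α : ℚ_[5]) + A * P⁻¹) * ((α : ℚ_[5]) ^ 2 + (A * P⁻¹) ^ 2)) +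
          (B * P⁻¹ - β) * ((B * P⁻¹ + β) * ((B * P⁻¹) ^ 2 + (β : ℚ_[5]) ^ 2)) := by
      push_cast; linear_combination hsq
    rw [hid]
    -- every cofactor has norm `≤ 1`
    have hco : ∀ (u v : ℚ_[5]), ‖u‖ ≤ 1 → ‖v‖ ≤ 1 → ‖(u + v) * (u ^ 2 + v ^ 2)‖ ≤ 1 := by
      intro u v hu hv
      rw [norm_mul]
      have h1 : ‖u + v‖ ≤ 1 := (IsUltrametricDist.norm_add_le_max _ _).trans (max_le hu hv)
      have h2 : ‖u ^ 2 + v ^ 2‖ ≤ 1 := by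
        refine (IsUltrametricDist.norm_add_le_max _ _).trans (max_le ?_ ?_)
        · rw [norm_pow]; exact pow_le_one₀ (norm_nonneg _) hu
        · rw [norm_pow]; exact pow_le_one₀ (norm_nonneg _) hv
      calc ‖u + v‖ * ‖u ^ 2 + v ^ 2‖ ≤ 1 * 1 := by gcongr
        _ = 1 := one_mul _
    refine (IsUltrametricDist.norm_add_le_max _ _).trans (max_le ?_ ?_)
    · rw [norm_mul, ← norm_neg ((α : ℚ_[5]) - A * P⁻¹), neg_sub]
      calc ‖A * P⁻¹ - α‖ * ‖((α : ℚ_[5]) + A * P⁻¹) * ((α : ℚ_[5]) ^ 2 + (A * P⁻¹) ^ 2)‖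
          ≤ 1 / (5 : ℝ) ^ N * 1 := by gcongr; exact hco _ _ hαn.le hle1A
        _ = 1 / (5 : ℝ) ^ N := mul_one _
    · rw [norm_mul]
      calc ‖B * P⁻¹ - β‖ * ‖(B * P⁻¹ + β) * ((B * P⁻¹) ^ 2 + (β : ℚ_[5]) ^ 2)‖ ≤ 1 / (5 : ℝ) ^ N * 1 := by
            gcongr; exact hco _ _ hle1B hβn.le
        _ = 1 / (5 : ℝ) ^ N := mul_one _
  have hdvd : (5 : ℤ) ^ N ∣ α ^ 4 - β ^ 4 := pow_dvd_of_norm_le hdiff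
  exact hcert (by rw [show β ^ 4 - α ^ 4 = -(α ^ 4 - β ^ 4) by ring]; exact hdvd.neg_right)
end Summit.BirchSwinnertonDyer.Rank1Residual.X11b.RegMult.KernelCertFive
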